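import Literature.Geometry.Riemannian.BakryEmeryHeatFlow
import HarnessLib

/-!
# The `f`-flux identity family on a closed normalised 4-d gradient shrinker
(stub `stub_fluxIdentityF` of line `cgy-variance-pivot`, crux `EntropyRung.CompactShrinkerGap`,
item stmt-SmoothPoincare4-10870)

For a Riemannian metric `g` (Levi-Civita connection) on a closed `4`-manifold and a smooth `f`
with `Ric + Hess f = g/2` and `R + |∇f|² = f` (a normalised gradient shrinker, `τ = 1`), and any
smooth `φ : ℝ → ℝ`:

  `∫_M (φ'(f) |∇f|² − φ(f) (f − 2)) e^{-f} dV = 0`.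

This is the drift-Laplacian equation `Δ_f f = Δf − |∇f|² = 2 − f` tested against `φ(f) e^{-f} dV`:
on the closed manifold `∫ ψ (Δ_f u) e^{-f} dV = −∫ g⁻¹(dψ, du) e^{-f} dV`.

Proof (one Green identity, all integrands continuous on a compact manifold of finite volume):
put `w(t) = φ(t) e^{-t}`, so `w' = (φ' − φ) e^{-t}`.
* Green's first identity on the closed manifold (`integral_mul_dalembertian_riemVolume`,
  Lee 2018, Problem 2-23 (a)) with `u = w ∘ f`, `v = f`, and the chain rule `d(w ∘ f) = w'(f) df`
  (`mvfderiv_real_comp_apply`): `∫ w(f) Δf dV = −∫ w'(f) |∇f|² dV`;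
* the traced soliton equation `R + Δf = 2` (`IsGradientShrinker.scalarCurvature_add_dalembertian_one`,
  `finrank ℝ ℝ⁴ = 4`, Carrillo–Ni 2009, (2.1)) and the normalisation `R = f − |∇f|²` give
  `Δf = 2 − f + |∇f|²`;
* hence `∫ φ(f) e^{-f} (2 − f + |∇f|²) + ∫ (φ' − φ)(f) e^{-f} |∇f|² = 0`, which is the claim after
  cancelling `∫ φ(f) |∇f|² e^{-f}`.

Sanity members: `φ ≡ 1` gives `∫ (f − 2) e^{-f} = 0` (the weighted mean of `f` is `2`);
`φ(t) = t − 2` gives the weighted Dirichlet identity W1 `∫ |∇f|² e^{-f} = ∫ (f − 2)² e^{-f}`.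
On the round `S⁴(√6)` with `f ≡ 2` every member reads `0 = 0`.
Everything is proved; no definition, no named fact.

References: J. A. Carrillo, L. Ni, Comm. Anal. Geom. 17 (2009), §2 (2.1)–(2.3) and §3 (3.1)–(3.2)
[CarrilloNi2009]; H.-D. Cao, M. Zhu, arXiv:1008.0842, (3.6)–(3.7) [CaoZhu2010];
J. M. Lee, *Introduction to Riemannian Manifolds* (2018), Problem 2-23 [Lee2018].
-/

noncomputable section

-- the registered namespace `Summit.SmoothPoincare4.SmoothPoincare4.Theorems` repeats a component
set_option linter.dupNamespace false

open Bundle Set Function Filter Module MeasureTheory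
open scoped Manifold ContDiff Topology

namespace Summit.SmoothPoincare4.SmoothPoincare4.Theorems

open Literature.Geometry Literature.Geometry.Lorentzian Literature.Geometry.Riemannian
  Literature.Geometry.Lorentzian.PseudoRiemannianMetric

/-- The derivative of the weight `w(t) = φ(t) e^{-t}` is `w'(t) = (φ'(t) − φ(t)) e^{-t}` for a
differentiable `φ`. [folklore] -/
private theorem hasDerivAt_mul_exp_neg {φ : ℝ → ℝ} {t : ℝ} (hφ : DifferentiableAt ℝ φ t) :
    HasDerivAt (fun s ↦ φ s * Real.exp (-s)) ((deriv φ t - φ t) * Real.exp (-t)) t := by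
  have h1 : HasDerivAt φ (deriv φ t) t := hφ.hasDerivAt
  have h2 : HasDerivAt (fun s : ℝ ↦ Real.exp (-s)) (-Real.exp (-t)) t := by
    simpa using (hasDerivAt_neg t).exp
  exact (h1.fun_mul h2).congr_deriv (by ring)

/-- **STUB `stub_fluxIdentityF` of line `cgy-variance-pivot` — the `f`-flux identity family of a
closed normalised shrinker.** For `g` Riemannian (Levi-Civita) on a closed 4-manifold, `f` smooth
with `Ric + Hess f = g/2`, `R + |∇f|² = f`, and any smooth `φ : ℝ → ℝ`:
`∫ (φ'(f) |∇f|² − φ(f)(f − 2)) e^{-f} dV = 0`, i.e. `Δ_f f = 2 − f` tested against `φ(f) e^{-f}`.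
Proof: Green's first identity `∫ w(f) Δf dV = −∫ g⁻¹(d(w ∘ f), df) dV`
(`integral_mul_dalembertian_riemVolume`) for the weight `w = φ e^{-t}`, the chain rule
`d(w ∘ f) = w'(f) df` with `w' = (φ' − φ) e^{-t}`, and `Δf = 2 − R = 2 − f + |∇f|²`
(`IsGradientShrinker.scalarCurvature_add_dalembertian_one`, `finrank ℝ ℝ⁴ = 4`, normalisation).
Members: `φ ≡ 1`: `∫ (f − 2) e^{-f} = 0`; `φ = t − 2`: W1. Check: round `S⁴(√6)`, `f ≡ 2`: `0 = 0`.
[cite: CarrilloNi2009, §2 (2.1)–(2.3) and §3 (3.1)–(3.2)] [cite: Lee2018, Problem 2-23 (a)] -/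
theorem stub_fluxIdentityF :
    ∀ (M : Type) [TopologicalSpace M] [T2Space M] [SecondCountableTopology M]
      [ChartedSpace (EuclideanSpace ℝ (Fin 4)) M] [IsManifold (𝓡 4) ∞ M] [CompactSpace M]
      [T3Space M] [MeasurableSpace M] [BorelSpace M]
      (g : Literature.Geometry.Lorentzian.PseudoRiemannianMetric (𝓡 4) ∞ (EuclideanSpace ℝ (Fin 4))
        (TangentSpace (𝓡 4) : M → Type _)) [g.HasLeviCivita] (f : M → ℝ) (hg : g.IsRiemannian),
      ContMDiff (𝓡 4) 𝓘(ℝ, ℝ) ∞ f →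
      (∀ (x : M) (X Y : TangentSpace (𝓡 4) x),
        g.ricci x X Y + g.hessian f x X Y = (1 / 2 : ℝ) * g.val x X Y) →
      (∀ x : M, g.scalarCurvature x + g.gradSq f x = f x) →
      ∀ φ : ℝ → ℝ, ContDiff ℝ ∞ φ →
      ∫ x, (deriv φ (f x) * g.gradSq f x - φ (f x) * (f x - 2)) * Real.exp (-f x)
          ∂(Literature.Geometry.Lorentzian.riemannianMeasure (g.toContMDiffRiemannianMetric hg)) = 0 := by
  intro M _ _ _ _ _ _ _ _ _ g _ f hg hf hsol hnorm φ hφ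
  -- the Riemannian measure is `g.riemVolume`
  have hV : g.riemVolume = riemannianMeasure (g.toContMDiffRiemannianMetric hg) :=
    PseudoRiemannianMetric.riemVolume_eq hg
  rw [← hV]
  have hE : finrank ℝ (EuclideanSpace ℝ (Fin 4)) = 4 := finrank_euclideanSpace_fin
  -- the traced soliton equation `R + Δf = 2` and the normalisation `R = f − |∇f|²`
  have hshr : g.IsGradientShrinker f 1 := (g.isGradientShrinker_one_iff f).2 hsol
  have hΔf : ∀ x, g.dalembertian f x = 2 - f x + g.gradSq f x := fun x ↦ by
    have h := hshr.scalarCurvature_add_dalembertian_one x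
    rw [hE] at h
    have h2 := hnorm x
    norm_num at h
    linarith
  -- regularity
  have hf1 : ContMDiff (𝓡 4) 𝓘(ℝ, ℝ) 1 f := hf.of_le (by norm_num)
  have hf2 : ContMDiff (𝓡 4) 𝓘(ℝ, ℝ) 2 f := hf.of_le (WithTop.coe_le_coe.mpr le_top)
  have hwC : ContDiff ℝ ∞ (fun t : ℝ ↦ φ t * Real.exp (-t)) :=
    hφ.mul (Real.contDiff_exp.comp contDiff_neg)
  have hw1 : ContMDiff (𝓡 4) 𝓘(ℝ, ℝ) 1 (fun y ↦ φ (f y) * Real.exp (-f y)) :=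
    (hwC.comp_contMDiff hf).of_le (by norm_num)
  have hφd : Differentiable ℝ φ := hφ.differentiable (by simp)
  -- continuity of the integrands
  have hφc : Continuous fun x ↦ φ (f x) := hφ.continuous.comp hf.continuous
  have hφ'c : Continuous fun x ↦ deriv φ (f x) :=
    (hφ.continuous_deriv (by simp)).comp hf.continuous
  have hGc : Continuous (g.gradSq f) := (contMDiff_gradSq g hf).continuous
  have hEc : Continuous fun x ↦ Real.exp (-f x) := Real.continuous_exp.comp hf.continuous.neg
  have iA : Integrable (fun x ↦ φ (f x) * Real.exp (-f x) * (2 - f x + g.gradSq f x))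
      g.riemVolume :=
    g.integrable_of_continuous
      ((hφc.mul hEc).mul ((continuous_const.sub hf.continuous).add hGc))
  have iB : Integrable (fun x ↦ (deriv φ (f x) - φ (f x)) * Real.exp (-f x) * g.gradSq f x)
      g.riemVolume :=
    g.integrable_of_continuous (((hφ'c.sub hφc).mul hEc).mul hGc)
  -- pointwise: `g⁻¹(d(w ∘ f), df) = w'(f) |∇f|²` (chain rule `d(w ∘ f) = w'(f) df`)
  have hR : ∀ x, g.innerDual x
      (mvfderiv (𝓡 4) (fun y ↦ φ (f y) * Real.exp (-f y)) x : TangentSpace (𝓡 4) x →ₗ[ℝ] ℝ)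
      (mvfderiv (𝓡 4) f x : TangentSpace (𝓡 4) x →ₗ[ℝ] ℝ) =
      (deriv φ (f x) - φ (f x)) * Real.exp (-f x) * g.gradSq f x := by
    intro x
    have hgrad : g.innerDual x (mvfderiv (𝓡 4) f x : TangentSpace (𝓡 4) x →ₗ[ℝ] ℝ)
        (mvfderiv (𝓡 4) f x : TangentSpace (𝓡 4) x →ₗ[ℝ] ℝ) = g.gradSq f x := rfl
    have hd : (mvfderiv (𝓡 4) (fun y ↦ φ (f y) * Real.exp (-f y)) x :
        TangentSpace (𝓡 4) x →ₗ[ℝ] ℝ) =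
        ((deriv φ (f x) - φ (f x)) * Real.exp (-f x)) •
          (mvfderiv (𝓡 4) f x : TangentSpace (𝓡 4) x →ₗ[ℝ] ℝ) := by
      ext v
      simp only [ContinuousLinearMap.coe_coe, LinearMap.smul_apply, smul_eq_mul]
      exact mvfderiv_real_comp_apply (I := 𝓡 4) (hasDerivAt_mul_exp_neg (hφd (f x)))
        (hf1.mdifferentiableAt one_ne_zero) v
    rw [hd, g.innerDual_smul_left, hgrad]
  -- Green's first identity: `∫ w(f) Δf dV = −∫ g⁻¹(d(w ∘ f), df) dV`
  have key : ∫ x, φ (f x) * Real.exp (-f x) * (2 - f x + g.gradSq f x) ∂g.riemVolume =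
      -∫ x, (deriv φ (f x) - φ (f x)) * Real.exp (-f x) * g.gradSq f x ∂g.riemVolume := by
    have hG := integral_mul_dalembertian_riemVolume g hg hw1 hf2
    simp_rw [hΔf, hR] at hG
    exact hG
  -- split the integrand: `(φ' |∇f|² − φ (f − 2)) e^{-f} = w(f) Δf + w'(f) |∇f|²`
  have hsplit : ∀ x, (deriv φ (f x) * g.gradSq f x - φ (f x) * (f x - 2)) * Real.exp (-f x) =
      φ (f x) * Real.exp (-f x) * (2 - f x + g.gradSq f x) +
        (deriv φ (f x) - φ (f x)) * Real.exp (-f x) * g.gradSq f x := fun x ↦ by ring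
  simp_rw [hsplit]
  rw [integral_add iA iB, key]
  ring

end Summit.SmoothPoincare4.SmoothPoincare4.Theorems

end
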